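import Summits.AtomisticToContinuum.Crystallization.Theorems.OverbindingBudgetBasalGapRigidity
import Summits.AtomisticToContinuum.Crystallization.Theorems.OverbindingBudgetTwoShellShape
import Summits.AtomisticToContinuum.Crystallization.Theorems.ChartedPlanarOrderTubeMonotoneSplit

/-!
# OverbindingBudget — slot 7 in W currency: stacked pieces, Nash balance from independence, and `BasalGapRigidity ⟸ tube monotonicity ∧ a balanced clean reference` (lens-4 g30, part XVIII)

Helper file (`--supports stmt-AtomisticToContinuum-31280`).  Critic row 445 ordered for generation 30: (i) the W-twin of part XV
(`…OverbindingBudgetBasalGapRigidity`), so that slot 7 of the RDEF cone of record (thirteenth form,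
`…OverbindingBudgetTwoShellShape.rdef_of_grossU_shape_gluing`, slot 7 = `BalancedLayeredCleanW Λ`) MOVES to the stacked pieces in W currency
(`IsClean ↦ IsCleanW`, pattern scale `≤ 103/100`); (ii) `basalGapRigidity_of_pairDominance : AdjacentPairDominance → FarPairStiffnessL1 →
(pinning lemma) → BasalGapRigidity`, or the exact delta.  Both are filed here, with two findings:

* **Nash balance needs no cleanliness (§2).**  Lens-3's landed `nashBalance_holds` uses `IsClean` only to obtain independence of the in-plane
  periods (`cleanStackedIndependent_holds`); part XV's pieces carry `LinearIndependent ℝ ![a, b]` as a binder, so the constant transmitted gap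
  stress follows POINTWISE from `hasSum_layerForce_of_isNash`, `summable_pairFamily_straddle` and `gapStress_succ_sub` for every separated
  single-site-Nash stacked configuration with independent periods (`gapStress_const_of_indep`).  Hence in W currency
  `BalancedStackedCleanW Λ₁ ⟸ GapStressVanishesW Λ₁ ∧ BasalGapRigidityW Λ₁` with NO third hypothesis (§3), and
  `BalancedLayeredCleanW Λ ⟸ StackedReductionW Λ Λ₁ ∧ BalancedStackedCleanW Λ₁`.
* **The delta of (ii) is an EXISTENCE statement (§4).**  Lens-3's W `TubeMonotone Λ₁ η` ALONE gives UNIQUENESS of the increment profile among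
  all profiles of the `η`-tube with the same transmitted stress across every gap (`eq_of_equal_stress`: the own-gap strong monotonicity `λ`
  beats the off-gap `ℓ¹` mass `Σκ − κ₀`, a contraction in the sup norm of the increment differences — which are AUTOMATICALLY bounded by `2η`,
  so the bounded-offset hypothesis of `ProfileSlavingLJ` is not needed when the two stresses agree).  What remains of `BasalGapRigidity` is
  therefore exactly the «registry / height / in-plane pinning lemma» as an existence statement: **`BasalReference Λ₁ η`** — next to every
  admissible stress-free stacked configuration with zero gap stress there is, over the SAME in-plane periods, a stacked profile whose
  increments lie in the `η`-tube, whose gap stresses vanish, and whose layered set is uniformly clean.  Seams PROVED: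
  `basalGapRigidity_of_tube_reference : TubeMonotone Λ₁ η → BasalReference Λ₁ η → BasalGapRigidity Λ₁`, hence with lens-3's landed glue
  `tubeMonotone_of_near_far'` ★ `basalGapRigidity_of_pairDominance : FarPairStiffnessL1 Λ₁ η K → AdjacentPairDominance Λ₁ η K →
  BasalReference Λ₁ η → BasalGapRigidity Λ₁` (critic row 445 (ii), literal currency), and the W-currency twin
  `basalGapRigidityW_of_tube_reference : TubeMonotoneW Λ₁ η → BasalReferenceW Λ₁ η → BasalGapRigidityW Λ₁`.
  READING RULE (inherited from lens-3 row 419 (1)): `η` below half the minimal layer height (tube profiles keep layers apart) and at least the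
  cleanliness tolerance of the increments (`≈ 1/16 · 103/100 + 10⁻³`), e.g. `η ∈ [1/12, 1/4]`.
* Cones (§5): FOURTEENTH form `rdef_of_grossU_shape_gluing_stackedW` (slot 7 ↦ `StackedReductionW Λ Λ₁ ∧ GapStressVanishesW Λ₁ ∧
  BasalGapRigidityW Λ₁`), FIFTEENTH form `rdef_of_grossU_shape_gluing_tubeW` (further `BasalGapRigidityW Λ₁ ↦ TubeMonotoneW Λ₁ η ∧
  BasalReferenceW Λ₁ η`); every other slot verbatim.
TAGS. `StackedReductionW` [UNDECIDED·TRUE-type; CERT-family·L] · `GapStressVanishesW` [ANALYTIC·M] · `BasalGapRigidityW` [CERT] ·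
`TubeMonotoneW` [= lens-3 W in W currency; INSTRUMENTABLE, census TAG 138′/161: λ₁ vs far mass `Σ s²τ_s − τ_1`] · `BasalReference(W)`
[ANALYTIC·M: implicit-function existence of the balanced stacking over a near-triangular in-plane lattice + the metric check «uniformly clean at
2 %», the in-plane lattice being pinned by the in-plane components of `StressFree`; CERT for the window constants].
No `sorry`, no new axioms, no `instance` / `notation`; `[folklore]` bookkeeping only.
-/

noncomputable section

namespace Summit.AtomisticToContinuum.Crystallization.Theorems.OverbindingBudgetStackedRigidityW

open Metric Filter Topology
open scoped RealInnerProductSpace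
open Summit.AtomisticToContinuum.Crystallization.Theses.OverbindingBudget (RobustDefectLimitWindows)
open Summit.AtomisticToContinuum.Crystallization.Theses.PricedLinkCensus (ChargedEnergyGap)
open Summit.AtomisticToContinuum.Crystallization.Theorems.OverbindingBudgetGradedBareness (CleanlessExcessT)
open Summit.AtomisticToContinuum.Crystallization.Theorems.OverbindingBudgetCoherentCut (CoherentResidual)
open Summit.AtomisticToContinuum.Crystallization.Theorems.OverbindingBudgetUniformCutStatements (GrossCleanBallsU)
open Summit.AtomisticToContinuum.Crystallization.Theorems.OverbindingBudgetViolatorDensityFloor (RT)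
open Summit.AtomisticToContinuum.Crystallization.Theorems.OverbindingBudgetRecurrentDustStatements (rt_translate)
open Summit.AtomisticToContinuum.Crystallization.Theorems.OverbindingBudgetElasticSplitStatements (VirialBalanced)
open Summit.AtomisticToContinuum.Crystallization.Theorems.OverbindingBudgetElasticSplitScale (CompressedVirialLaw)
open Summit.AtomisticToContinuum.Crystallization.Theorems.OverbindingBudgetElasticSplitShear (StressFree)
open Summit.AtomisticToContinuum.Crystallization.Theorems.ChartedPlanarOrderChunkFloor (E3)
open Summit.AtomisticToContinuum.Crystallization.Theorems.ChartedPlanarOrderRigidityDoor (IsClean IsNash)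
open Summit.AtomisticToContinuum.Crystallization.Theorems.ChartedPlanarOrderDensityDichotomy (μS IsSep)
open Summit.AtomisticToContinuum.Crystallization.Theorems.ChartedPlanarOrderDoorLayered (Layered)
open Summit.AtomisticToContinuum.Crystallization.Theorems.ChartedPlanarOrderProfileSlavingLJ (layerForce IsStacked gapStress incr tube
  NashBalance TubeMonotone translation_iff_incr_eq)
open Summit.AtomisticToContinuum.Crystallization.Theorems.ChartedPlanarOrderProfileSlavingLJBalance (pairFamily straddleSet gapStress_succ_sub)
open Summit.AtomisticToContinuum.Crystallization.Theorems.ChartedPlanarOrderProfileSlavingLJLayerBalance (layerForce_zero)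
open Summit.AtomisticToContinuum.Crystallization.Theorems.ChartedPlanarOrderNashForceBalance (hasSum_layerForce_of_isNash)
open Summit.AtomisticToContinuum.Crystallization.Theorems.ChartedPlanarOrderStraddleSummable (summable_pairFamily_straddle)
open Summit.AtomisticToContinuum.Crystallization.Theorems.ChartedPlanarOrderTubeMonotoneSplit (FarPairStiffnessL1 AdjacentPairDominance
  tubeMonotone_of_near_far' eta_nonneg incr_mem_tube norm_sub_le_two_eta)
open Summit.AtomisticToContinuum.Crystallization.Theorems.OverbindingBudgetPeriodicCleanOrStrained (UniformlyClean)
open Summit.AtomisticToContinuum.Crystallization.Theorems.OverbindingBudgetScaleWidening (IsCleanW DoorPeriodicW BalancedLayeredCleanW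
  isClean_imp_W)
open Summit.AtomisticToContinuum.Crystallization.Theorems.OverbindingBudgetTwoShellShape (TwoShellShape BarlowGluingW
  rdef_of_grossU_shape_gluing)
open Summit.AtomisticToContinuum.Crystallization.Theorems.OverbindingBudgetBasalGapRigidity (BalancedStackedClean StackedReduction
  GapStressVanishes BasalGapRigidity)

/-! ## §1 The stacked pieces in W currency (`IsClean ↦ IsCleanW`; each STRONGER than its part-XV literal) -/

/-- `BalancedStackedClean Λ₁` with the widened cleanliness hypothesis. [piece] -/
def BalancedStackedCleanW (Λ₁ : ℝ) : Prop :=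
  ∀ δ : ℝ, 0 < δ → ∀ (a b : E3) (w : ℤ → E3), IsStacked a b w → LinearIndependent ℝ ![a, b] →
    ‖a‖ ≤ Λ₁ → ‖b‖ ≤ Λ₁ → IsSep δ (Layered a b w) → IsCleanW (μS (Layered a b w)) → IsNash (μS (Layered a b w)) →
    VirialBalanced (Layered a b w) → StressFree (Layered a b w) → UniformlyClean (Layered a b w)

/-- `StackedReduction Λ Λ₁` with the widened cleanliness hypothesis (the rigidity-bearing re-representation as a stacked configuration with
in-plane periods of norm `≤ Λ₁`). [UNDECIDED·TRUE-type; CERT-family·L] [piece] -/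
def StackedReductionW (Λ Λ₁ : ℝ) : Prop :=
  ∀ δ : ℝ, 0 < δ → ∀ (a b : E3) (w : ℤ → E3), LinearIndependent ℝ ![a, b] → ‖a‖ ≤ Λ → ‖b‖ ≤ Λ →
    IsSep δ (Layered a b w) → IsCleanW (μS (Layered a b w)) → IsNash (μS (Layered a b w)) →
    VirialBalanced (Layered a b w) → StressFree (Layered a b w) →
    ∃ (a₁ b₁ : E3) (w₁ : ℤ → E3), Layered a₁ b₁ w₁ = Layered a b w ∧ IsStacked a₁ b₁ w₁ ∧
      LinearIndependent ℝ ![a₁, b₁] ∧ ‖a₁‖ ≤ Λ₁ ∧ ‖b₁‖ ≤ Λ₁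

/-- `GapStressVanishes Λ₁` with the widened cleanliness hypothesis (a constant transmitted gap stress of a stress-free configuration is zero).
[ANALYTIC·M] [piece] -/
def GapStressVanishesW (Λ₁ : ℝ) : Prop :=
  ∀ δ : ℝ, 0 < δ → ∀ (a b : E3) (w : ℤ → E3), IsStacked a b w → LinearIndependent ℝ ![a, b] →
    ‖a‖ ≤ Λ₁ → ‖b‖ ≤ Λ₁ → IsSep δ (Layered a b w) → IsCleanW (μS (Layered a b w)) → IsNash (μS (Layered a b w)) →
    StressFree (Layered a b w) → ∀ σ : E3, (∀ m : ℤ, gapStress a b m (incr w) = σ) → σ = 0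

/-- `BasalGapRigidity Λ₁` with the widened cleanliness hypothesis (zero stress across every gap forces uniform cleanliness). [CERT] [piece] -/
def BasalGapRigidityW (Λ₁ : ℝ) : Prop :=
  ∀ δ : ℝ, 0 < δ → ∀ (a b : E3) (w : ℤ → E3), IsStacked a b w → LinearIndependent ℝ ![a, b] →
    ‖a‖ ≤ Λ₁ → ‖b‖ ≤ Λ₁ → IsSep δ (Layered a b w) → IsCleanW (μS (Layered a b w)) → IsNash (μS (Layered a b w)) →
    StressFree (Layered a b w) → (∀ m : ℤ, gapStress a b m (incr w) = 0) → UniformlyClean (Layered a b w)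

/-- The W pieces are STRONGER than the literal ones: `BalancedStackedCleanW → BalancedStackedClean`. [this file] -/
theorem balancedStackedClean_of_W {Λ₁ : ℝ} (h : BalancedStackedCleanW Λ₁) : BalancedStackedClean Λ₁ :=
  fun δ hδ a b w hst hab ha hb hs hc hn hv hf => h δ hδ a b w hst hab ha hb hs (isClean_imp_W hc) hn hv hf

/-- `StackedReductionW → StackedReduction`. [this file] -/
theorem stackedReduction_of_W {Λ Λ₁ : ℝ} (h : StackedReductionW Λ Λ₁) : StackedReduction Λ Λ₁ :=
  fun δ hδ a b w hab ha hb hs hc hn hv hf => h δ hδ a b w hab ha hb hs (isClean_imp_W hc) hn hv hf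

/-- `GapStressVanishesW → GapStressVanishes`. [this file] -/
theorem gapStressVanishes_of_W {Λ₁ : ℝ} (h : GapStressVanishesW Λ₁) : GapStressVanishes Λ₁ :=
  fun δ hδ a b w hst hab ha hb hs hc hn hf => h δ hδ a b w hst hab ha hb hs (isClean_imp_W hc) hn hf

/-- `BasalGapRigidityW → BasalGapRigidity`. [this file] -/
theorem basalGapRigidity_of_W {Λ₁ : ℝ} (h : BasalGapRigidityW Λ₁) : BasalGapRigidity Λ₁ :=
  fun δ hδ a b w hst hab ha hb hs hc hn hf => h δ hδ a b w hst hab ha hb hs (isClean_imp_W hc) hn hf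

/-! ## §2 Nash balance from independence alone (no cleanliness) -/

/-- **Constant transmitted gap stress, POINTWISE** — for every `δ`-separated single-site-Nash stacked layered configuration with linearly
independent in-plane periods (lens-3's `hasSum_layerForce_of_isNash`, `summable_pairFamily_straddle`, `gapStress_succ_sub`; the induction of
`nashBalance_of_layerForceBalance`).  No cleanliness hypothesis. [this file] -/
theorem gapStress_const_of_indep {δ : ℝ} {a b : E3} {w : ℤ → E3} (hδ : 0 < δ) (hab : LinearIndependent ℝ ![a, b])
    (hst : IsStacked a b w) (hS : IsSep δ (Layered a b w)) (hN : IsNash (μS (Layered a b w))) :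
    ∃ σ : E3, ∀ m : ℤ, gapStress a b m (incr w) = σ := by
  have hSm : ∀ m : ℤ, Summable (pairFamily a b w ∘ (↑) : straddleSet m → E3) := fun m =>
    summable_pairFamily_straddle hδ hab hst hS m
  have hA : ∀ m : ℤ, HasSum (fun l : {l : ℤ // l ≠ m} => layerForce a b (w m - w l)) 0 := fun m =>
    hasSum_layerForce_of_isNash hδ hab hst hS hN (layerForce_zero a b) m
  have step : ∀ m : ℤ, gapStress a b (m + 1) (incr w) = gapStress a b m (incr w) := fun m => by
    have h := gapStress_succ_sub a b w m (hSm m) (hSm (m + 1)) (hA m).summable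
    rw [(hA m).tsum_eq] at h
    exact sub_eq_zero.mp h
  refine ⟨gapStress a b 0 (incr w), fun m => ?_⟩
  induction m using Int.induction_on with
  | zero => rfl
  | succ n ih => rw [step, ih]
  | pred n ih =>
    have := step (-(n : ℤ) - 1)
    rw [sub_add_cancel] at this
    rw [← ih, ← this]

/-- `NashBalance Λ` in W currency, PROVED (every `Λ`; independence as a binder). [this file] -/
theorem nashBalanceW_holds {δ : ℝ} {a b : E3} {w : ℤ → E3} (hδ : 0 < δ) (hst : IsStacked a b w) (hab : LinearIndependent ℝ ![a, b])
    (hS : IsSep δ (Layered a b w)) (_hC : IsCleanW (μS (Layered a b w))) (hN : IsNash (μS (Layered a b w))) :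
    ∃ σ : E3, ∀ m : ℤ, gapStress a b m (incr w) = σ :=
  gapStress_const_of_indep hδ hab hst hS hN

/-! ## §3 Seams in W currency -/

/-- **Seam, PROVED.** `GapStressVanishesW Λ₁ → BasalGapRigidityW Λ₁ → BalancedStackedCleanW Λ₁` (Nash balance from §2). [this file] -/
theorem balancedStackedCleanW_of_pieces {Λ₁ : ℝ} (hV : GapStressVanishesW Λ₁) (hR : BasalGapRigidityW Λ₁) :
    BalancedStackedCleanW Λ₁ := by
  intro δ hδ a b w hst hab ha hb hsep hcl hna _hvb hsf
  obtain ⟨σ, hσ⟩ := gapStress_const_of_indep hδ hab hst hsep hna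
  have hσ0 : σ = 0 := hV δ hδ a b w hst hab ha hb hsep hcl hna hsf σ hσ
  exact hR δ hδ a b w hst hab ha hb hsep hcl hna hsf fun m => by rw [hσ m, hσ0]

/-- **Seam, PROVED.** `StackedReductionW Λ Λ₁ → BalancedStackedCleanW Λ₁ → BalancedLayeredCleanW Λ`. [this file] -/
theorem balancedLayeredCleanW_of_stackedW {Λ Λ₁ : ℝ} (hSR : StackedReductionW Λ Λ₁) (hBS : BalancedStackedCleanW Λ₁) :
    BalancedLayeredCleanW Λ := by
  intro δ hδ a b w hab ha hb hsep hcl hna hvb hsf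
  obtain ⟨a₁, b₁, w₁, hEq, hst, hab₁, ha₁, hb₁⟩ := hSR δ hδ a b w hab ha hb hsep hcl hna hvb hsf
  have h := hBS δ hδ a₁ b₁ w₁ hst hab₁ ha₁ hb₁ (hEq ▸ hsep) (hEq ▸ hcl) (hEq ▸ hna) (hEq ▸ hvb) (hEq ▸ hsf)
  rwa [hEq] at h

/-- `StackedReductionW Λ Λ₁ → GapStressVanishesW Λ₁ → BasalGapRigidityW Λ₁ → BalancedLayeredCleanW Λ`. [this file] -/
theorem balancedLayeredCleanW_of_basalW {Λ Λ₁ : ℝ} (hSR : StackedReductionW Λ Λ₁) (hV : GapStressVanishesW Λ₁)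
    (hR : BasalGapRigidityW Λ₁) : BalancedLayeredCleanW Λ :=
  balancedLayeredCleanW_of_stackedW hSR (balancedStackedCleanW_of_pieces hV hR)

/-- In the literal currency too the third hypothesis of part XV's seam is discharged: `GapStressVanishes Λ₁ → BasalGapRigidity Λ₁ →
BalancedStackedClean Λ₁`. [this file] -/
theorem balancedStackedClean_of_two {Λ₁ : ℝ} (hV : GapStressVanishes Λ₁) (hR : BasalGapRigidity Λ₁) : BalancedStackedClean Λ₁ := by
  intro δ hδ a b w hst hab ha hb hsep hcl hna _hvb hsf
  obtain ⟨σ, hσ⟩ := gapStress_const_of_indep hδ hab hst hsep hna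
  have hσ0 : σ = 0 := hV δ hδ a b w hst hab ha hb hsep hcl hna hsf σ hσ
  exact hR δ hδ a b w hst hab ha hb hsep hcl hna hsf fun m => by rw [hσ m, hσ0]

/-! ## §4 `BasalGapRigidity ⟸ tube monotonicity (uniqueness) ∧ a balanced clean reference (existence)` -/

/-- **Uniqueness kernel, PROVED.**  For an abstract gap map `Φ` with the two inequalities of lens-3's `TubeMonotone` on windows `W`
(`λ`-strong monotonicity in the own increment, `ℓ¹`-Lipschitz with weights `κ ≥ 0`, `Σκ − κ₀ < λ`), two window profiles at bounded distance with
the SAME value of `Φ` across every gap coincide: `λ‖h m − h' m‖ ≤ (Σκ − κ₀) · sup‖h − h'‖` for every `m`, a contraction. [folklore] -/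
theorem eq_of_equal_stress {W : ℤ → Set E3} {Φ : ℤ → (ℤ → E3) → E3} {lam : ℝ} {κ : ℤ → ℝ}
    (hκ0 : ∀ j, 0 ≤ κ j) (hκs : Summable κ) (hdom : (∑' j, κ j) - κ 0 < lam)
    (hmono : ∀ m : ℤ, ∀ h : ℤ → E3, (∀ k, h k ∈ W k) → ∀ b' ∈ W m,
      lam * ‖h m - b'‖ ^ 2 ≤ ⟪Φ m h - Φ m (Function.update h m b'), h m - b'⟫)
    (hlip : ∀ m : ℤ, ∀ h h' : ℤ → E3, (∀ k, h k ∈ W k) → (∀ k, h' k ∈ W k) →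
      ‖Φ m h - Φ m h'‖ ≤ ∑' j : ℤ, κ j * ‖h (m + j) - h' (m + j)‖)
    {h h' : ℤ → E3} (hh : ∀ k, h k ∈ W k) (hh' : ∀ k, h' k ∈ W k) {D : ℝ} (hD : ∀ k, ‖h k - h' k‖ ≤ D)
    (heq : ∀ m, Φ m h = Φ m h') : h = h' := by
  classical
  set ρ : ℝ := (∑' j, κ j) - κ 0 with hρ
  have hρ0 : 0 ≤ ρ := by
    have h1 : ∑ j ∈ ({0} : Finset ℤ), κ j ≤ ∑' j, κ j := hκs.sum_le_tsum {0} (fun j _ => hκ0 j)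
    rw [Finset.sum_singleton] at h1
    linarith
  have hlam : 0 < lam := lt_of_le_of_lt hρ0 hdom
  have hθ0 : 0 ≤ ρ / lam := div_nonneg hρ0 hlam.le
  have hθ1 : ρ / lam < 1 := (div_lt_one hlam).mpr hdom
  -- the contraction step
  have key : ∀ D : ℝ, (∀ k, ‖h k - h' k‖ ≤ D) → ∀ m, ‖h m - h' m‖ ≤ ρ / lam * D := by
    intro D hD m
    have hD0 : 0 ≤ D := (norm_nonneg _).trans (hD 0)
    set g : ℤ → E3 := Function.update h m (h' m) with hg
    have hgW : ∀ k, g k ∈ W k := fun k => by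
      rcases eq_or_ne k m with rfl | hne
      · rw [hg, Function.update_self]; exact hh' k
      · rw [hg, Function.update_of_ne hne]; exact hh k
    have hmo := hmono m h hh (h' m) (hh' m)
    have hli := hlip m h' g hh' hgW
    have hterm : ∀ j : ℤ, κ j * ‖h' (m + j) - g (m + j)‖ ≤ κ j * D - if j = 0 then κ 0 * D else 0 := by
      intro j
      by_cases hj : j = 0
      · subst hj
        simp [hg]
      · rw [if_neg hj, sub_zero]
        refine mul_le_mul_of_nonneg_left ?_ (hκ0 j)
        have hne : m + j ≠ m := by intro hc; exact hj (by linarith)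
        rw [hg, Function.update_of_ne hne, norm_sub_rev]
        exact hD (m + j)
    have hterm' : ∀ j : ℤ, κ j * ‖h' (m + j) - g (m + j)‖ ≤ κ j * D := fun j =>
      (hterm j).trans (by split_ifs <;> nlinarith [hκ0 0, hD0])
    have hsum1 : Summable (fun j : ℤ => κ j * ‖h' (m + j) - g (m + j)‖) :=
      Summable.of_nonneg_of_le (fun j => mul_nonneg (hκ0 j) (norm_nonneg _)) hterm' (hκs.mul_right D)
    have hite : HasSum (fun j : ℤ => if j = 0 then κ 0 * D else 0) (κ 0 * D) := hasSum_ite_eq 0 _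
    have hsum2 : Summable (fun j : ℤ => κ j * D - if j = 0 then κ 0 * D else 0) := (hκs.mul_right D).sub hite.summable
    have hbound : ∑' j : ℤ, κ j * ‖h' (m + j) - g (m + j)‖ ≤ ρ * D := by
      calc ∑' j : ℤ, κ j * ‖h' (m + j) - g (m + j)‖ ≤ ∑' j : ℤ, (κ j * D - if j = 0 then κ 0 * D else 0) :=
            hsum1.tsum_le_tsum hterm hsum2
        _ = (∑' j : ℤ, κ j * D) - ∑' j : ℤ, (if j = 0 then κ 0 * D else 0) := (hκs.mul_right D).tsum_sub hite.summable
        _ = ρ * D := by rw [tsum_mul_right, hite.tsum_eq, hρ]; ring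
    have hin : ⟪Φ m h - Φ m g, h m - h' m⟫ ≤ ‖Φ m h' - Φ m g‖ * ‖h m - h' m‖ := by
      rw [heq m]; exact real_inner_le_norm _ _
    have h1 : lam * ‖h m - h' m‖ ^ 2 ≤ ρ * D * ‖h m - h' m‖ :=
      hmo.trans (hin.trans (mul_le_mul_of_nonneg_right (hli.trans hbound) (norm_nonneg _)))
    by_cases hz : ‖h m - h' m‖ = 0
    · rw [hz]; exact mul_nonneg hθ0 hD0
    · have hpos : 0 < ‖h m - h' m‖ := lt_of_le_of_ne (norm_nonneg _) (Ne.symm hz)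
      have h2 : lam * ‖h m - h' m‖ ≤ ρ * D := by
        have h3 : lam * ‖h m - h' m‖ * ‖h m - h' m‖ ≤ ρ * D * ‖h m - h' m‖ := by rw [mul_assoc, ← sq]; exact h1
        exact le_of_mul_le_mul_right h3 hpos
      rw [div_mul_eq_mul_div, le_div_iff₀ hlam]
      linarith
  -- iterate the contraction
  obtain ⟨D₀, hD₀⟩ : ∃ D₀ : ℝ, ∀ k, ‖h k - h' k‖ ≤ D₀ := ⟨D, hD⟩
  have iter : ∀ n : ℕ, ∀ k, ‖h k - h' k‖ ≤ (ρ / lam) ^ n * D₀ := by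
    intro n
    induction n with
    | zero => simpa using hD₀
    | succ n ih =>
      intro k
      calc ‖h k - h' k‖ ≤ ρ / lam * ((ρ / lam) ^ n * D₀) := key _ ih k
        _ = (ρ / lam) ^ (n + 1) * D₀ := by ring
  have hlim : Tendsto (fun n : ℕ => (ρ / lam) ^ n * D₀) atTop (𝓝 0) := by
    have := (tendsto_pow_atTop_nhds_zero_of_lt_one hθ0 hθ1).mul_const D₀
    simpa using this
  funext k
  have hk : ‖h k - h' k‖ ≤ 0 := ge_of_tendsto' hlim fun n => iter n k
  exact sub_eq_zero.mp (norm_le_zero_iff.mp hk)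

/-- **Corollary for the LJ gap stress, PROVED.**  Around an admissible configuration carrying lens-3's tube data, the increment profile is the
ONLY profile of its `η`-tube with the same gap stresses (in particular the only zero-stress one). [this file] -/
theorem incr_eq_of_tube_data {a b : E3} {w : ℤ → E3} {η lam : ℝ} {κ : ℤ → ℝ}
    (hκ0 : ∀ j, 0 ≤ κ j) (hκs : Summable κ) (hdom : (∑' j, κ j) - κ 0 < lam)
    (hmono : ∀ m : ℤ, ∀ h : ℤ → E3, (∀ k, h k ∈ tube w η k) → ∀ b' ∈ tube w η m,
      lam * ‖h m - b'‖ ^ 2 ≤ ⟪gapStress a b m h - gapStress a b m (Function.update h m b'), h m - b'⟫)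
    (hlip : ∀ m : ℤ, ∀ h h' : ℤ → E3, (∀ k, h k ∈ tube w η k) → (∀ k, h' k ∈ tube w η k) →
      ‖gapStress a b m h - gapStress a b m h'‖ ≤ ∑' j : ℤ, κ j * ‖h (m + j) - h' (m + j)‖)
    {h' : ℤ → E3} (hh' : ∀ k, h' k ∈ tube w η k) (heq : ∀ m, gapStress a b m (incr w) = gapStress a b m h') : incr w = h' :=
  have hη : 0 ≤ η := eta_nonneg hh'
  have hh : ∀ k, incr w k ∈ tube w η k := fun k => incr_mem_tube hη k
  eq_of_equal_stress hκ0 hκs hdom hmono hlip hh hh' (fun k => norm_sub_le_two_eta hh hh' k) heq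

/-- A translate of a uniformly clean set is uniformly clean. [folklore] -/
theorem uniformlyClean_translate {Y : Set E3} (v : E3) (h : UniformlyClean Y) : UniformlyClean ((fun p => p - v) '' Y) := by
  obtain ⟨a', h1, h2, hRT⟩ := h
  refine ⟨a', h1, h2, ?_⟩
  rintro _ ⟨y, hy, rfl⟩ s hs
  exact rt_translate v (hRT y hy s hs)

/-- Shifting every offset by `c` translates the layered set. [folklore] -/
theorem layered_add_const (a b : E3) (w : ℤ → E3) (c : E3) :
    Layered a b (fun m => w m + c) = (fun p => p - (-c)) '' Layered a b w := by
  ext p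
  constructor
  · rintro ⟨m, i, j, rfl⟩
    exact ⟨((i : ℝ) • a + (j : ℝ) • b) + w m, ⟨m, i, j, rfl⟩, by simp only [sub_neg_eq_add, add_assoc]⟩
  · rintro ⟨q, ⟨m, i, j, rfl⟩, rfl⟩
    exact ⟨m, i, j, by simp only [sub_neg_eq_add, add_assoc]⟩

/-- **Pointwise seam, PROVED.**  Tube data around `w` + a profile `w'` over the same periods whose increments lie in the tube, whose gap
stresses equal those of `w`, and whose layered set is uniformly clean ⇒ `Layered a b w` is uniformly clean (it is a translate). [this file] -/
theorem uniformlyClean_of_tube_reference {a b : E3} {w w' : ℤ → E3} {η lam : ℝ} {κ : ℤ → ℝ}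
    (hκ0 : ∀ j, 0 ≤ κ j) (hκs : Summable κ) (hdom : (∑' j, κ j) - κ 0 < lam)
    (hmono : ∀ m : ℤ, ∀ h : ℤ → E3, (∀ k, h k ∈ tube w η k) → ∀ b' ∈ tube w η m,
      lam * ‖h m - b'‖ ^ 2 ≤ ⟪gapStress a b m h - gapStress a b m (Function.update h m b'), h m - b'⟫)
    (hlip : ∀ m : ℤ, ∀ h h' : ℤ → E3, (∀ k, h k ∈ tube w η k) → (∀ k, h' k ∈ tube w η k) →
      ‖gapStress a b m h - gapStress a b m h'‖ ≤ ∑' j : ℤ, κ j * ‖h (m + j) - h' (m + j)‖)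
    (htube : ∀ m, incr w' m ∈ tube w η m) (heq : ∀ m, gapStress a b m (incr w) = gapStress a b m (incr w'))
    (hUC : UniformlyClean (Layered a b w')) : UniformlyClean (Layered a b w) := by
  have hincr : incr w = incr w' := incr_eq_of_tube_data hκ0 hκs hdom hmono hlip htube heq
  obtain ⟨c, hc⟩ := (translation_iff_incr_eq w' w).mpr fun m => by rw [hincr]
  have hw : w = fun m => w' m + c := funext hc
  rw [hw, layered_add_const]
  exact uniformlyClean_translate (-c) hUC

/-- **THE PINNING LEMMA as an existence statement · `BasalReference Λ₁ η`** (literal currency): next to every `δ`-separated clean single-site-Nash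
stress-free stacked configuration with independent in-plane periods of norm `≤ Λ₁` and ZERO transmitted stress across every gap there is, over the
SAME in-plane periods, a stacked offset profile whose increments lie in the `η`-tube of the given ones, whose gap stresses vanish, and whose
layered set is uniformly clean.  (Registry: hollow sites; heights: the balanced solution of the banded gap equations, within `10⁻³` of
`√(2/3)·s`; in-plane lattice pinned near triangular by the in-plane components of `StressFree` — the metric check «uniformly clean at 2 %» is
where these constants enter.) [ANALYTIC·M + CERT; TRUE-type for `η ≥` the increment tolerance of `IsClean`] [piece] -/
def BasalReference (Λ₁ η : ℝ) : Prop :=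
  ∀ δ : ℝ, 0 < δ → ∀ (a b : E3) (w : ℤ → E3), IsStacked a b w → LinearIndependent ℝ ![a, b] →
    ‖a‖ ≤ Λ₁ → ‖b‖ ≤ Λ₁ → IsSep δ (Layered a b w) → IsClean (μS (Layered a b w)) → IsNash (μS (Layered a b w)) →
    StressFree (Layered a b w) → (∀ m : ℤ, gapStress a b m (incr w) = 0) →
    ∃ w' : ℤ → E3, IsStacked a b w' ∧ (∀ m : ℤ, incr w' m ∈ tube w η m) ∧ (∀ m : ℤ, gapStress a b m (incr w') = 0) ∧
      UniformlyClean (Layered a b w')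

/-- `BasalReference` in W currency (`IsClean ↦ IsCleanW`; STRONGER). [piece] -/
def BasalReferenceW (Λ₁ η : ℝ) : Prop :=
  ∀ δ : ℝ, 0 < δ → ∀ (a b : E3) (w : ℤ → E3), IsStacked a b w → LinearIndependent ℝ ![a, b] →
    ‖a‖ ≤ Λ₁ → ‖b‖ ≤ Λ₁ → IsSep δ (Layered a b w) → IsCleanW (μS (Layered a b w)) → IsNash (μS (Layered a b w)) →
    StressFree (Layered a b w) → (∀ m : ℤ, gapStress a b m (incr w) = 0) →
    ∃ w' : ℤ → E3, IsStacked a b w' ∧ (∀ m : ℤ, incr w' m ∈ tube w η m) ∧ (∀ m : ℤ, gapStress a b m (incr w') = 0) ∧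
      UniformlyClean (Layered a b w')

/-- Lens-3's W in W currency (`IsClean ↦ IsCleanW`; STRONGER than `TubeMonotone Λ η`). [INSTRUMENTABLE, census TAG 138′/161] [piece] -/
def TubeMonotoneW (Λ η : ℝ) : Prop :=
  ∀ δ : ℝ, 0 < δ → ∀ (a b : E3) (w : ℤ → E3), ‖a‖ ≤ Λ → ‖b‖ ≤ Λ →
    IsSep δ (Layered a b w) → IsCleanW (μS (Layered a b w)) → IsNash (μS (Layered a b w)) → IsStacked a b w →
    ∃ (lam : ℝ) (κ : ℤ → ℝ), (∀ j, 0 ≤ κ j) ∧ Summable κ ∧ Summable (fun j : ℤ => |(j : ℝ)| * κ j) ∧ (∑' j, κ j) - κ 0 < lam ∧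
      (∀ m : ℤ, ∀ h : ℤ → E3, (∀ k, h k ∈ tube w η k) → ∀ b' ∈ tube w η m,
        lam * ‖h m - b'‖ ^ 2 ≤ ⟪gapStress a b m h - gapStress a b m (Function.update h m b'), h m - b'⟫) ∧
      (∀ m : ℤ, ∀ h h' : ℤ → E3, (∀ k, h k ∈ tube w η k) → (∀ k, h' k ∈ tube w η k) →
        ‖gapStress a b m h - gapStress a b m h'‖ ≤ ∑' j : ℤ, κ j * ‖h (m + j) - h' (m + j)‖)

/-- `BasalReferenceW → BasalReference`. [this file] -/
theorem basalReference_of_W {Λ₁ η : ℝ} (h : BasalReferenceW Λ₁ η) : BasalReference Λ₁ η :=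
  fun δ hδ a b w hst hab ha hb hs hc hn hf hz => h δ hδ a b w hst hab ha hb hs (isClean_imp_W hc) hn hf hz

/-- `TubeMonotoneW → TubeMonotone`. [this file] -/
theorem tubeMonotone_of_W {Λ η : ℝ} (h : TubeMonotoneW Λ η) : TubeMonotone Λ η :=
  fun δ hδ a b w ha hb hs hc hn hst => h δ hδ a b w ha hb hs (isClean_imp_W hc) hn hst

/-- **Seam, PROVED (literal currency).** `TubeMonotone Λ₁ η → BasalReference Λ₁ η → BasalGapRigidity Λ₁`. [this file] -/
theorem basalGapRigidity_of_tube_reference {Λ₁ η : ℝ} (hT : TubeMonotone Λ₁ η) (hR : BasalReference Λ₁ η) :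
    BasalGapRigidity Λ₁ := by
  intro δ hδ a b w hst hab ha hb hsep hcl hna hsf hzero
  obtain ⟨w', _hst', htube, hzero', hUC⟩ := hR δ hδ a b w hst hab ha hb hsep hcl hna hsf hzero
  obtain ⟨lam, κ, hκ0, hκs, _hκ1, hdom, hmono, hlip⟩ := hT δ hδ a b w ha hb hsep hcl hna hst
  exact uniformlyClean_of_tube_reference hκ0 hκs hdom hmono hlip htube (fun m => by rw [hzero m, hzero' m]) hUC

/-- ★ **Critic row 445 (ii), PROVED with the delta named.** `FarPairStiffnessL1 Λ₁ η K → AdjacentPairDominance Λ₁ η K → BasalReference Λ₁ η →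
BasalGapRigidity Λ₁` (lens-3's landed glue `tubeMonotone_of_near_far'` by name; the delta is the existence statement `BasalReference Λ₁ η`). [this file] -/
theorem basalGapRigidity_of_pairDominance {Λ₁ η : ℝ} {K : ℝ → ℝ} (hF : FarPairStiffnessL1 Λ₁ η K)
    (hN : AdjacentPairDominance Λ₁ η K) (hR : BasalReference Λ₁ η) : BasalGapRigidity Λ₁ :=
  basalGapRigidity_of_tube_reference (tubeMonotone_of_near_far' hF hN) hR

/-- **Seam, PROVED (W currency).** `TubeMonotoneW Λ₁ η → BasalReferenceW Λ₁ η → BasalGapRigidityW Λ₁`. [this file] -/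
theorem basalGapRigidityW_of_tube_reference {Λ₁ η : ℝ} (hT : TubeMonotoneW Λ₁ η) (hR : BasalReferenceW Λ₁ η) :
    BasalGapRigidityW Λ₁ := by
  intro δ hδ a b w hst hab ha hb hsep hcl hna hsf hzero
  obtain ⟨w', _hst', htube, hzero', hUC⟩ := hR δ hδ a b w hst hab ha hb hsep hcl hna hsf hzero
  obtain ⟨lam, κ, hκ0, hκs, _hκ1, hdom, hmono, hlip⟩ := hT δ hδ a b w ha hb hsep hcl hna hst
  exact uniformlyClean_of_tube_reference hκ0 hκs hdom hmono hlip htube (fun m => by rw [hzero m, hzero' m]) hUC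

/-! ## §5 The cone, fourteenth and fifteenth forms -/

/-- **RDEF cone, fourteenth form** (every `Λ`, `Λ₁`): `GrossCleanBallsU (1/250) 10 → ChargedEnergyGap → CompressedVirialLaw (1/250) 10 →
TwoShellShape (1/100) (3/50) (1/450) → BarlowGluingW → DoorPeriodicW Λ → StackedReductionW Λ Λ₁ → GapStressVanishesW Λ₁ → BasalGapRigidityW Λ₁ →
CleanlessExcessT → CoherentResidual 10 → RobustDefectLimitWindows` — the thirteenth form with slot 7 cut in W currency. [this file] -/
theorem rdef_of_grossU_shape_gluing_stackedW (Λ Λ₁ : ℝ) (hG : GrossCleanBallsU (1 / 250) 10) (hCEG : ChargedEnergyGap)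
    (hC : CompressedVirialLaw (1 / 250) 10) (hS : TwoShellShape (1 / 100) (3 / 50) (1 / 450)) (hB₂ : BarlowGluingW) (hD : DoorPeriodicW Λ)
    (hSR : StackedReductionW Λ Λ₁) (hV : GapStressVanishesW Λ₁) (hR : BasalGapRigidityW Λ₁)
    (hCE : CleanlessExcessT) (hRes : CoherentResidual 10) : RobustDefectLimitWindows :=
  rdef_of_grossU_shape_gluing Λ hG hCEG hC hS hB₂ hD (balancedLayeredCleanW_of_basalW hSR hV hR) hCE hRes

/-- **RDEF cone, fifteenth form** (every `Λ`, `Λ₁`, `η`): as the fourteenth with `BasalGapRigidityW Λ₁ ↦ TubeMonotoneW Λ₁ η ∧ BasalReferenceW Λ₁ η`.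
[this file] -/
theorem rdef_of_grossU_shape_gluing_tubeW (Λ Λ₁ η : ℝ) (hG : GrossCleanBallsU (1 / 250) 10) (hCEG : ChargedEnergyGap)
    (hC : CompressedVirialLaw (1 / 250) 10) (hS : TwoShellShape (1 / 100) (3 / 50) (1 / 450)) (hB₂ : BarlowGluingW) (hD : DoorPeriodicW Λ)
    (hSR : StackedReductionW Λ Λ₁) (hV : GapStressVanishesW Λ₁) (hT : TubeMonotoneW Λ₁ η) (hRef : BasalReferenceW Λ₁ η)
    (hCE : CleanlessExcessT) (hRes : CoherentResidual 10) : RobustDefectLimitWindows :=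
  rdef_of_grossU_shape_gluing_stackedW Λ Λ₁ hG hCEG hC hS hB₂ hD hSR hV (basalGapRigidityW_of_tube_reference hT hRef) hCE hRes

end Summit.AtomisticToContinuum.Crystallization.Theorems.OverbindingBudgetStackedRigidityW

end
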